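import Summits.BirchSwinnertonDyer.Rank1Residual.X1.DoubleTwistDisplayKit
import Summits.BirchSwinnertonDyer.Rank1Residual.X2.RouteGThreeTorsionCount
import Summits.BirchSwinnertonDyer.Rank1Residual.Partition.EisensteinKernelCertificate
import Summits.BirchSwinnertonDyer.Rank1Residual.X2.CongruentPartnerAnomalous
import Summits.BirchSwinnertonDyer.Rank1Residual.X11b.ChaPairsMinimality
import Summits.BirchSwinnertonDyer.Rank1Residual.X11b.KrausMinimalityTwoUnit
import Summits.BirchSwinnertonDyer.BirchSwinnertonDyer.Theorems.Rank1ResidualIntModelReduction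
import Summits.BirchSwinnertonDyer.BirchSwinnertonDyer.Theorems.Rank1ResidualX11RankOneReduction
import Literature.NumberTheory.EllipticCurves.Rank1Residual.X1ThreeDescentCertificate
import HarnessLib

/-!
# Row A2 (X1b: good anomalous Eisenstein prime, parity type B, `r_an = 1`) per pair, PREPRINT-FREE and SCHNEIDER-FREE descent road — display
# `2116c1 @ 3`: `BSD(2116c1, 3)` from Gross–Zagier–Kolyvagin alone + the two READS (`#Ш_an` a `3`-adic unit, `Ш[3] = 0` by the two
# `3`-isogeny-descent engines), through the Literature door `X1.bsdp_of_noPTorsion` (cell `bsd-eis`, seat `bsd-eis-k5-p4` g0;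
# RULING L84 (3) G2 display; THEOREMS ONLY — nothing booked; row A2 stays as booked class-wide)

HONEST FRAMING (FULL-BSD rank-≤1 programme D-0033, cell `bsd-eis`, run/shared/lean/pub/bsd-eis/; ladder row A2 = X1b: good anomalous Eisenstein prime, parity type B:
`p` good, anomalous, `E[p]` reducible, `r_an = 1`; 1 307 cells; class-wide road of record = Keller–Yin Thm D [PRE]; the GV-type-B + Schneider-C1 road of record where referee A has it).
This file is a twin of `EisensteinPrimesA1Descent1690h1.lean` (p545679): the Literature door `X1.bsdp_of_noPTorsion`
(`Rank1Residual/X1ThreeDescentCertificate.lean`, b2b prover B gen 5: `r_an ≤ 1 → ClassX1 W p → ord_p #Ш_an = 0 → Ш(W)[p] = 0 → BSDp W p`,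
named fact Gross–Zagier–Kolyvagin ONLY — no Keller–Yin, no Schneider certificate, no Iwasawa theory, no parity type) instantiated at the
window cell `2116c @3` (`N < 10⁴`) of the class-wide table `pub/bsd-eis/k5-p4-g0/a1a2/A1A2-DESC3R1-TABLE-v1.tsv` 505ef047eb96068b
(kit j282526/j283065/j283686): record `2116c1 = [0, 1, 0, 882, -4663]` (`N = 2116 = 2²·23²`, `3 ∤ N`), 3-isogeny kernel ``x + 8``,
`(s_φ̂, s_φ, m, EXCESS) = `(1, 0, 1, 0)`` identical on `isogchi` 42175383 ‖ `isogcft` 0e36e3a0 (`mw = 1`, `bnfcertify = 1`);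
`#Ш_an = 1` on every member (Cremona `allbsd` = PARI leg), `r_an = 1` (Cremona; PARI `ellanalyticrank`). The pair also carries the lw16 RESISO per-pair theorem `Resiso.bsdp3_resiso_2116c1` (`Rank1Residual/Resiso/P3/ResisoP3Part0010.lean`, class-free kernel, same reads) — two roads at one pair.
**IN THE KERNEL here:** `2116c1` elliptic, globally minimal (bounded Kraus criterion), GOOD ANOMALOUS at `3` (`3 ∤ Δ = -54477207152`,
`#Ẽ(𝔽_3) = 3`, `a_3 = 1 ≡ 1 (mod 3)`), `E[3]` reducible (rational `Ψ₃`-root `x₀ = -8`, `Ψ₂Sq(-8) = -48668 ≠ 0`); `ClassX1 2116c1 3` then follows GIVEN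
`r_an = 1` (the class's last clause `¬(r_an = 0 ∧ GVPar)` is vacuous in rank one — no parity-type certificate is needed on this road,
which is why the same door serves type A and type B alike).
**READ (hypotheses):** `hr : r_an = 1`, `hq`/`hv` : `#Ш_an = q`, `ord_3 q = 0`, `h : Ш[3] = 0`. **PUBLISHED fact BY NAME:** `hGZK` only.
Refs: [Miller2011LMS] Def. 1.1; [SilvermanAEC2009] VII.1 Rem. 1.1, VII.5 Prop. 5.1(a), Ex. 3.7, X.4.2; [Kraus1989] Prop. 1–2; Cremona `ecdata` class 2116c.
-/

set_option autoImplicit false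
set_option linter.dupNamespace false

noncomputable section

open scoped Classical

open WeierstrassCurve NumberField IsDedekindDomain Field
  Literature.NumberTheory.EllipticCurves
  Literature.NumberTheory.EllipticCurves.ModularForms
  Literature.NumberTheory.EllipticCurves.Rank1Residual
  Summit.BirchSwinnertonDyer.BirchSwinnertonDyer.Rank1Residual.IntModel
  Summit.BirchSwinnertonDyer.BirchSwinnertonDyer.Rank1Residual.X11RankOne
  Summit.BirchSwinnertonDyer.Rank1Residual.X11b
  Summit.BirchSwinnertonDyer.Rank1Residual.X2
  Summit.BirchSwinnertonDyer.Rank1Residual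

namespace Summit.BirchSwinnertonDyer.BirchSwinnertonDyer.Theorems.A2Descent2116c1

/-- `2116c1 = [0, 1, 0, 882, -4663]` is elliptic (`Δ = -54477207152 ≠ 0`). [folklore] -/
theorem isElliptic_2116c1 : (⟨0, 1, 0, 882, (-4663)⟩ : WeierstrassCurve ℚ).IsElliptic :=
  isElliptic_of_discOf_ne_zero 0 1 0 882 (-4663) (by decide +kernel)

set_option maxRecDepth 100000 in
/-- `2116c1` is globally minimal (bounded Kraus criterion; `|Δ| = 2⁴·23⁷ < 512¹²`). [cite: SilvermanAEC2009, VII.1 Remark 1.1]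
[cite: Kraus1989, Prop. 1 and Prop. 2] -/
theorem isGloballyMinimal_2116c1 : (⟨0, 1, 0, 882, (-4663)⟩ : WeierstrassCurve ℚ).IsGloballyMinimal :=
  isGloballyMinimal_of_krausCriterion_bounded₃ 0 1 0 882 (-4663)
    (by decide +kernel) (by decide +kernel) (by decide +kernel)

/-- **`2116c1` has GOOD, ANOMALOUS reduction at `3`**: `3 ∤ Δ` and `a_3 = 1` (`#Ẽ(𝔽_3) = 3`), so `3 ∣ a_3 − 1`.
[cite: SilvermanAEC2009, VII.5 Prop. 5.1(a)] -/
theorem good_frobeniusTrace_2116c1 [(⟨0, 1, 0, 882, (-4663)⟩ : WeierstrassCurve ℚ).IsGloballyMinimal] :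
    (⟨0, 1, 0, 882, (-4663)⟩ : WeierstrassCurve ℚ).HasGoodReductionAtPrime 3 ∧
      (⟨0, 1, 0, 882, (-4663)⟩ : WeierstrassCurve ℚ).frobeniusTrace 3 = 1 := by
  have hI := integralModelInt_eq_of_map_eq (W := (⟨0, 1, 0, 882, (-4663)⟩ : WeierstrassCurve ℚ)) _ (map_mk_int 0 1 0 882 (-4663))
  have hcard : Nat.card (((⟨0, 1, 0, 882, (-4663)⟩ : WeierstrassCurve ℤ).map (Int.castRingHom (ZMod 3))).toAffine.Point) = 3 := by
    rw [@WeierstrassCurve.natCard_point_eq_one_add_card (ZMod 3) (@ZMod.instField 3 ⟨by norm_num⟩) _ _ _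
      (by decide +kernel), @card_sol_eq_sum_euler (ZMod 3) (@ZMod.instField 3 ⟨by norm_num⟩) _ _
      (by rw [ZMod.ringChar_zmod_n]; decide), ZMod.card]
    decide +kernel
  refine ⟨hasGoodReductionAtPrime_of_not_dvd _ 3 (by rw [minimalDiscriminantInt, hI, intCurve_Δ]; decide +kernel), ?_⟩
  rw [frobeniusTrace_eq hI hcard]
  decide

/-- **`2116c1[3]` is reducible — IN THE KERNEL**: `x₀ = -8` is a rational root of `Ψ₃` with `Ψ₂Sq(-8) = -48668 ≠ 0` (the kernel of the
rational `3`-isogeny inside class `2116c`). [cite: SilvermanAEC2009, Ex. 3.7 and III.2.3] -/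
theorem not_irreducible_2116c1 : ¬ (⟨0, 1, 0, 882, (-4663)⟩ : WeierstrassCurve ℚ).HasIrreducibleModPGaloisRep 3 := by
  haveI := isElliptic_2116c1
  obtain ⟨Φ, P, y, h, hΦ, -⟩ :=
    KernelDisc.exists_isRationalLine_of_eval_Ψ₃_eq_zero (W := ⟨0, 1, 0, 882, (-4663)⟩) (-8)
      (by norm_num [WeierstrassCurve.Ψ₃, WeierstrassCurve.b₂, WeierstrassCurve.b₄, WeierstrassCurve.b₆,
            WeierstrassCurve.b₈])
      (by rw [KernelDisc.eval_Ψ₂Sq]; norm_num [WeierstrassCurve.b₂, WeierstrassCurve.b₄, WeierstrassCurve.b₆])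
  exact CongruentPartnerAnomalous.not_hasIrreducibleModPGaloisRep_of_isRationalLine hΦ

/-- **`ClassX1 2116c1 3` GIVEN analytic rank one** (`3 > 2`; reducible; good; anomalous `3 ∣ a_3 − 1`; the parity clause
`¬(r_an = 0 ∧ GVPar)` is vacuous when `r_an = 1`). [cite: SilvermanAEC2009, VII.5 Prop. 5.1, Ex. 3.7] -/
theorem classX1_2116c1 [(⟨0, 1, 0, 882, (-4663)⟩ : WeierstrassCurve ℚ).IsElliptic] [(⟨0, 1, 0, 882, (-4663)⟩ : WeierstrassCurve ℚ).IsGloballyMinimal]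
    (hr : (⟨0, 1, 0, 882, (-4663)⟩ : WeierstrassCurve ℚ).analyticRank = 1) : ClassX1 (⟨0, 1, 0, 882, (-4663)⟩ : WeierstrassCurve ℚ) 3 := by
  obtain ⟨hgood, ha⟩ := good_frobeniusTrace_2116c1
  have han : ((3 : ℕ) : ℤ) ∣ (⟨0, 1, 0, 882, (-4663)⟩ : WeierstrassCurve ℚ).frobeniusTrace 3 - 1 := by
    rw [ha]; decide
  exact ⟨by norm_num, not_irreducible_2116c1, hgood, ⟨not_irreducible_2116c1, hgood, han⟩, fun h' ↦ by omega⟩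

/-- **X1b INSTANCE, DESCENT ROAD — `BSD(2116c1, 3)`** from Gross–Zagier–Kolyvagin (`hGZK`) and the two READS on `2116c1` (`#Ш_an` a
`3`-adic unit; `Ш[3] = 0` by the two isogeny-descent engines), through the Literature door `X1.bsdp_of_noPTorsion`; `ClassX1` in the kernel
given the READ `hr`. No Keller–Yin input, no Schneider certificate, no parity type. Nothing booked; `BSDp` only. [cite: Miller2011LMS, §1 and Def. 1.1] -/
theorem bsdp_2116c1_at_three_of_descent (hGZK : rank_eq_analyticRank_of_analyticRank_le_one)
    (W : WeierstrassCurve ℚ) [W.IsElliptic] [W.IsGloballyMinimal] (hW : W = ⟨0, 1, 0, 882, (-4663)⟩)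
    (hr : W.analyticRank = 1) {q : ℚ} (hq : shaAn W = (q : ℂ)) (hv : padicValRat 3 q = 0)
    (h : ∀ x : W.sha, (3 : ℤ) • x = 0 → x = 0) : BSDp W 3 := by
  subst hW
  exact X1.bsdp_of_noPTorsion hGZK _ 3 (by omega) (classX1_2116c1 hr) hq hv h

/-- **The same on the row's shape `ClassX1 W 3 → r_an = 1 → BSDp W 3`** modulo GZK and the two reads. [cite: Miller2011LMS, §1 and Def. 1.1] -/
theorem classX1_rankOne_bsdp_2116c1_of_descent (hGZK : rank_eq_analyticRank_of_analyticRank_le_one)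
    (W : WeierstrassCurve ℚ) [W.IsElliptic] [W.IsGloballyMinimal] (hW : W = ⟨0, 1, 0, 882, (-4663)⟩)
    {q : ℚ} (hq : shaAn W = (q : ℂ)) (hv : padicValRat 3 q = 0) (h : ∀ x : W.sha, (3 : ℤ) • x = 0 → x = 0) :
    ClassX1 W 3 → W.analyticRank = 1 → BSDp W 3 :=
  fun _ hr ↦ bsdp_2116c1_at_three_of_descent hGZK W hW hr hq hv h

end Summit.BirchSwinnertonDyer.BirchSwinnertonDyer.Theorems.A2Descent2116c1

end
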